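import Mathlib
import HarnessLib


/-!
# The scalar step inequality of the dominating sequence: the two momentum regimes
# (Adams–Buchholz–Kotecký–Müller, Lemma 7.3, (7.36) and (7.39))

`WeightDominatingMultipliers.lean` reduces `WeightData.Dominated` for the torus weight tower to the
scalar inequality of [ABKM19] Lemma 7.3 at each non-zero Fourier mode ((7.45)):

  `(lam·m_k⁻¹ + (1+ε) t')⁻¹ + δ'·m_{k+1} ≤ (lam·m_{k+1}⁻¹ + (1+ε−μδ') t')⁻¹`,  `t' = Σ_{j≥k+2} c_j`.

Its proof splits into two regimes (Remark 7.4).  This file proves the ALGEBRA of both regimes for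
abstract non-negative reals, leaving to the instantiation only the verification of the regime
hypotheses from the shell bounds of the finite-range decomposition ((7.33)–(7.35), (7.37)–(7.38)):

* `step_high` — HIGH MOMENTA `|p| ≥ L^{−k+k₀}` ((7.36)): if `4 m_k ≤ m_{k+1}` ((7.34)),
  `2 t' ≤ lam·m_{k+1}⁻¹` ((7.35)), `δ' ≤ (4 lam)⁻¹` and `ε' ≤ 1`, then
  `(lam·m_k⁻¹ + (1+ε)t')⁻¹ + δ' m_{k+1} ≤ (lam·m_{k+1}⁻¹ + (1+ε')t')⁻¹`;
* `inv_sub_inv_ge` — the resolvent-type identity behind (7.39):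
  `(A + (B−D))⁻¹ − (A' + B)⁻¹ ≥ D / ((A + (B − D))(A + B))` for `A ≤ A'`, `0 ≤ D ≤ B`, `A > 0`;
* `step_low` — LOW MOMENTA `|p| < L^{−k+k₀}` ((7.39)–(7.40)): with two-sided bounds
  `ω₁ r ≤ t'`, `(1+ε) t' ≤ Ω₁ r`, `lam·m_{k+1}⁻¹ ≤ Ω₂ r`, `m_{k+1} ≤ K r⁻¹` (`r = |p|^{−2}`),
  `m_k ≤ m_{k+1}` and `μ ≥ K (Ω₁+Ω₂)²/ω₁`, `0 ≤ μδ' ≤ 1 + ε`: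
  `(lam·m_k⁻¹ + (1+ε)t')⁻¹ + δ' m_{k+1} ≤ (lam·m_{k+1}⁻¹ + (1+ε−μδ')t')⁻¹`.

Everything is proved; no named fact.

## References
* S. Adams, S. Buchholz, R. Kotecký, S. Müller, arXiv:1910.13564, Lemma 7.3 with Remark 7.4,
  (7.33)–(7.40) [AdamsBuchholzKoteckyMuller2019].
-/

noncomputable section

namespace Literature.MathematicalPhysics.StatisticalMechanics.GradientRG

/-! ## High momenta ((7.36)) -/

/-- **[ABKM19] (7.36), the high-momentum regime of Lemma 7.3.**  For `lam, m_k, m_{k+1} > 0`,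
`t' ≥ 0`, `ε ≥ −1`, `−1 ≤ ε' ≤ 1`: if `4 m_k ≤ m_{k+1}` ((7.34)), `2 t' ≤ lam·m_{k+1}⁻¹` ((7.35)) and
`δ' ≤ (4 lam)⁻¹`, then `(lam·m_k⁻¹ + (1+ε)t')⁻¹ + δ' m_{k+1} ≤ (lam·m_{k+1}⁻¹ + (1+ε')t')⁻¹`.
[cite: AdamsBuchholzKoteckyMuller2019, Lemma 7.3 (7.36)] -/
theorem step_high {lam mk mk1 t' ε ε' δ' : ℝ} (hlam : 0 < lam) (hmk : 0 < mk) (hmk1 : 0 < mk1)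
    (ht' : 0 ≤ t') (hε : 0 ≤ 1 + ε) (hε' : 0 ≤ 1 + ε') (hε'1 : ε' ≤ 1) (h34 : 4 * mk ≤ mk1)
    (h35 : 2 * t' ≤ lam * mk1⁻¹) (hδ : δ' ≤ (4 * lam)⁻¹) :
    (lam * mk⁻¹ + (1 + ε) * t')⁻¹ + δ' * mk1 ≤ (lam * mk1⁻¹ + (1 + ε') * t')⁻¹ := by
  have hA' : 0 < lam * mk⁻¹ := mul_pos hlam (inv_pos.2 hmk)
  have hA : 0 < lam * mk1⁻¹ := mul_pos hlam (inv_pos.2 hmk1)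
  -- `(lam m_k⁻¹ + (1+ε)t')⁻¹ ≤ m_k/lam ≤ m_{k+1}/(4 lam)`
  have h1 : (lam * mk⁻¹ + (1 + ε) * t')⁻¹ ≤ mk / lam :=
    calc (lam * mk⁻¹ + (1 + ε) * t')⁻¹ ≤ (lam * mk⁻¹)⁻¹ :=
          inv_anti₀ hA' (le_add_of_nonneg_right (mul_nonneg hε ht'))
      _ = mk / lam := by rw [mul_inv, inv_inv, div_eq_inv_mul]
  have h2 : mk / lam ≤ mk1 / (4 * lam) := by
    rw [div_le_div_iff₀ hlam (by linarith)]; nlinarith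
  -- `δ' m_{k+1} ≤ m_{k+1}/(4 lam)`
  have h3 : δ' * mk1 ≤ mk1 / (4 * lam) := by
    rw [div_eq_mul_inv, mul_comm mk1]
    exact mul_le_mul_of_nonneg_right hδ hmk1.le
  -- `(lam m_{k+1}⁻¹ + (1+ε')t')⁻¹ ≥ (2 lam m_{k+1}⁻¹)⁻¹ = m_{k+1}/(2 lam)`
  have h4 : mk1 / (2 * lam) ≤ (lam * mk1⁻¹ + (1 + ε') * t')⁻¹ := by
    have heq : mk1 / (2 * lam) = (2 * (lam * mk1⁻¹))⁻¹ := by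
      rw [mul_inv, mul_inv, inv_inv]; ring
    rw [heq]
    refine inv_anti₀ (add_pos_of_pos_of_nonneg hA (mul_nonneg hε' ht')) ?_
    have : (1 + ε') * t' ≤ 2 * t' := mul_le_mul_of_nonneg_right (by linarith) ht'
    linarith
  have h5 : mk1 / (4 * lam) + mk1 / (4 * lam) = mk1 / (2 * lam) := by
    field_simp; ring
  linarith

/-! ## Low momenta ((7.39)–(7.40)) -/

/-- **The resolvent-type inequality behind (7.39)**: for `0 < A ≤ A'`, `0 ≤ D ≤ B`:
`D/(A + B)² ≤ (A + (B − D))⁻¹ − (A' + B)⁻¹`. [cite: AdamsBuchholzKoteckyMuller2019, Lemma 7.3 (7.39)] -/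
theorem div_sq_le_inv_sub_inv {A A' B D : ℝ} (hA : 0 < A) (hAA' : A ≤ A') (hD : 0 ≤ D) (hDB : D ≤ B) :
    D / (A + B) ^ 2 ≤ (A + (B - D))⁻¹ - (A' + B)⁻¹ := by
  have hB : 0 ≤ B := hD.trans hDB
  have h1 : 0 < A + (B - D) := by linarith
  have h2 : 0 < A + B := by linarith
  have h3 : 0 < A' + B := by linarith
  -- `(A'+B)⁻¹ ≤ (A+B)⁻¹`
  have h4 : (A' + B)⁻¹ ≤ (A + B)⁻¹ := inv_anti₀ h2 (by linarith)
  -- `(A+(B−D))⁻¹ − (A+B)⁻¹ = D/((A+B−D)(A+B)) ≥ D/(A+B)²`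
  have h5 : (A + (B - D))⁻¹ - (A + B)⁻¹ = D / ((A + (B - D)) * (A + B)) := by
    field_simp; ring
  have h6 : D / (A + B) ^ 2 ≤ D / ((A + (B - D)) * (A + B)) := by
    refine div_le_div_of_nonneg_left hD (mul_pos h1 h2) ?_
    rw [sq]; exact mul_le_mul_of_nonneg_right (by linarith) h2.le
  linarith

/-- **[ABKM19] (7.39)–(7.40), the low-momentum regime of Lemma 7.3.**  At a mode with `r = |p|^{−2}`
suppose the two-sided bounds ((7.37)–(7.38)) `ω₁ r ≤ t'`, `(1+ε) t' ≤ Ω₁ r`, `lam·m_{k+1}⁻¹ ≤ Ω₂ r`,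
`m_{k+1} ≤ K r⁻¹`, and `0 < m_k ≤ m_{k+1}`, `lam > 0`, `0 ≤ μ δ' ≤ 1 + ε`, `δ' ≥ 0`,
`K (Ω₁+Ω₂)² ≤ μ ω₁` ((7.40)).  Then
`(lam·m_k⁻¹ + (1+ε)t')⁻¹ + δ' m_{k+1} ≤ (lam·m_{k+1}⁻¹ + (1+ε−μδ')t')⁻¹`.
[cite: AdamsBuchholzKoteckyMuller2019, Lemma 7.3 (7.39)-(7.40)] -/
theorem step_low {lam mk mk1 t' ε δ' μ r ω₁ Ω₁ Ω₂ K : ℝ} (hlam : 0 < lam) (hmk : 0 < mk)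
    (hmkmk1 : mk ≤ mk1) (hr : 0 < r) (hδ0 : 0 ≤ δ') (hμδ : μ * δ' ≤ 1 + ε) (hμ0 : 0 ≤ μ)
    (hω : ω₁ * r ≤ t') (hΩ₁ : (1 + ε) * t' ≤ Ω₁ * r) (hΩ₂ : lam * mk1⁻¹ ≤ Ω₂ * r)
    (hK : mk1 ≤ K * r⁻¹) (hμ : K * (Ω₁ + Ω₂) ^ 2 ≤ μ * ω₁) (hω0 : 0 ≤ ω₁) :
    (lam * mk⁻¹ + (1 + ε) * t')⁻¹ + δ' * mk1 ≤ (lam * mk1⁻¹ + (1 + ε - μ * δ') * t')⁻¹ := by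
  have hmk1 : 0 < mk1 := lt_of_lt_of_le hmk hmkmk1
  have ht' : 0 ≤ t' := le_trans (mul_nonneg hω0 hr.le) hω
  set A := lam * mk1⁻¹ with hAdef
  set A' := lam * mk⁻¹ with hA'def
  set B := (1 + ε) * t' with hBdef
  set D := μ * δ' * t' with hDdef
  have hA : 0 < A := mul_pos hlam (inv_pos.2 hmk1)
  have hAA' : A ≤ A' := mul_le_mul_of_nonneg_left ((inv_le_inv₀ hmk1 hmk).2 hmkmk1) hlam.le
  have hD : 0 ≤ D := mul_nonneg (mul_nonneg hμ0 hδ0) ht'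
  have hDB : D ≤ B := by rw [hDdef, hBdef]; exact mul_le_mul_of_nonneg_right hμδ ht'
  have hkey := div_sq_le_inv_sub_inv hA hAA' hD hDB
  have hrew : A + (B - D) = lam * mk1⁻¹ + (1 + ε - μ * δ') * t' := by
    rw [hAdef, hBdef, hDdef]; ring
  rw [← hrew]
  -- it remains: `δ' m_{k+1} ≤ D/(A+B)²`
  suffices h : δ' * mk1 ≤ D / (A + B) ^ 2 by linarith
  have hAB : A + B ≤ (Ω₁ + Ω₂) * r := by rw [hAdef, hBdef]; linarith
  have hABpos : 0 < A + B := by have := hD.trans hDB; linarith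
  -- `D/(A+B)² ≥ μ δ' ω₁ r / ((Ω₁+Ω₂)² r²)` and `δ' m_{k+1} ≤ δ' K / r`
  have h1 : δ' * mk1 ≤ δ' * (K * r⁻¹) := mul_le_mul_of_nonneg_left hK hδ0
  have h2 : μ * δ' * (ω₁ * r) / ((Ω₁ + Ω₂) * r) ^ 2 ≤ D / (A + B) ^ 2 := by
    have hnum : μ * δ' * (ω₁ * r) ≤ D := by
      rw [hDdef]; exact mul_le_mul_of_nonneg_left hω (mul_nonneg hμ0 hδ0)
    calc μ * δ' * (ω₁ * r) / ((Ω₁ + Ω₂) * r) ^ 2 ≤ μ * δ' * (ω₁ * r) / (A + B) ^ 2 := by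
          refine div_le_div_of_nonneg_left (by positivity) (pow_pos hABpos 2) ?_
          exact pow_le_pow_left₀ hABpos.le hAB 2
      _ ≤ D / (A + B) ^ 2 := div_le_div_of_nonneg_right hnum (sq_nonneg _)
  have h3 : δ' * (K * r⁻¹) ≤ μ * δ' * (ω₁ * r) / ((Ω₁ + Ω₂) * r) ^ 2 := by
    -- equivalent to `δ' K (Ω₁+Ω₂)² ≤ δ' μ ω₁` after clearing `r > 0`
    have hr0 : r ≠ 0 := hr.ne'
    by_cases hS : Ω₁ + Ω₂ = 0
    · -- then `A + B ≤ 0`, contradiction with `A > 0`, `B ≥ D ≥ 0`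
      exfalso; rw [hS, zero_mul] at hAB; linarith [hD.trans hDB]
    · have hS2 : 0 < (Ω₁ + Ω₂) ^ 2 := by positivity
      rw [mul_pow, div_mul_eq_div_div, le_div_iff₀ (by positivity), div_eq_mul_inv,
        show ((Ω₁ + Ω₂) ^ 2)⁻¹ = 1 / (Ω₁ + Ω₂) ^ 2 from (one_div _).symm]
      rw [← sub_nonneg]
      have : μ * δ' * (ω₁ * r) * (1 / (Ω₁ + Ω₂) ^ 2) - δ' * (K * r⁻¹) * r ^ 2 =
          δ' * r * (μ * ω₁ - K * (Ω₁ + Ω₂) ^ 2) / (Ω₁ + Ω₂) ^ 2 := by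
        field_simp
      rw [this]
      exact div_nonneg (mul_nonneg (mul_nonneg hδ0 hr.le) (by linarith)) hS2.le
  linarith

end Literature.MathematicalPhysics.StatisticalMechanics.GradientRG

end
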